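import Mathlib
import Summits.ValiantsHypothesis.ValiantsHypothesis.Theorems.BarrierLeverPartitionMinorsHitByVPHiddenStatesPathTableFirstShell

/-!
# Route BarrierLever — item `PartitionMinorsHitByVP` (stmt-ValiantsHypothesis-19717), line `hidden-states`:
# THE FIRST SHELL OF HALF-BALL, COMPLETE: the case `k = 1` and all classes `B_t(2t+1) − A + C`, `A ⊄ C`

Helper file (`--supports stmt-ValiantsHypothesis-19717`; cell valiant-natproofs, 𝒟-side door (c), registered line
`Cruxes/PartitionMinorsHitByVP/Lines/hidden_states.lean` v8; prover seat val-np-p6 gen 16).  Closes NO item; definition-free.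
* `lambda_Y_ne_zero_one` — Theorem B at `k = 1` (the path table `y₀ = χ₀ + χ_p`, `y₁ = χ₁ + sχ₀`; value `−s`), hence
  `lambda_Y_ne_zero'` / `pathTable_det_ne_zero'` for every `k ≥ 1`.
* ★★ `exists_table_firstShell_all`, `gc_cell_firstShell_all` — for every `t`, ALL `A, C ⊆ Fin (2t+1)` with `|A| = t`, `|C| = t+1`,
  `A ⊄ C` (equivalently `t − |A ∩ C| ≥ 1`): the row families ranging in `B_t − {A} + {C}` are served by a table — THE ENTIRE FIRST
  SHELL of HALF-BALL (every down-set at swap distance one from the ball `B_t(2t+1)`), for every `t`, in the item's currency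
  (memo HOME/val-np-p6/g16/MEMO-valnp6-g16.md; planner mandate l.1434 (1)).

HONEST LABEL: cells of the GC½ conjecture column; 19717 stays OPEN; nothing on crux 14610 or VP ≠ VNP.
-/

set_option linter.dupNamespace false

namespace Summit.ValiantsHypothesis.ValiantsHypothesis.Theorems.BarrierLever.HiddenStates

open Finset

noncomputable section

namespace PathTable

variable {s : ℂ}

/-- Theorem B at `k = 1`: `Σ_{φ ∈ maps Y} wt(φ)·zk (Y.image φ) = −s ≠ 0`. -/
theorem lambda_Y_ne_zero_one (hs : s ≠ 0) :
    ∑ φ ∈ Fintype.piFinset (fun a => if a ∈ (Finset.univ : Finset (Fin (1 + 1))).image Sum.inl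
        then (Finset.univ : Finset (Fin (1 + 1) ⊕ Fin 1)) else {a}),
      (∏ a ∈ (Finset.univ : Finset (Fin (1 + 1))).image Sum.inl, pw 1 s a (φ a)) *
        zk 1 s (((Finset.univ : Finset (Fin (1 + 1))).image Sum.inl).image φ) ≠ 0 := by
  classical
  have hY : (Finset.univ : Finset (Fin (1 + 1))).image (Sum.inl : Fin (1 + 1) → Fin (1 + 1) ⊕ Fin 1) = Yj 1 (1 + 1) := by
    ext x; simp only [Finset.mem_image, Finset.mem_univ, true_and, mem_Yj]
    constructor
    · rintro ⟨b, rfl⟩; exact ⟨b, b.isLt, rfl⟩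
    · rintro ⟨b, -, rfl⟩; exact ⟨b, rfl⟩
  rw [hY]
  obtain ⟨hY1, hn1⟩ := Yj_succ (k := 1) (j := 1) le_rfl
  have hlast : (⟨1, by omega⟩ : Fin (1 + 1)) = Fin.last 1 := rfl
  rw [hlast] at hY1 hn1
  rw [hY1, sum_maps_insert (pw 1 s) (zk 1 s) hn1]
  have hstep1 : ∀ φ ∈ Fintype.piFinset (fun a => if a ∈ Yj 1 1 then (Finset.univ : Finset (Fin (1 + 1) ⊕ Fin 1)) else {a}),
      (∏ b ∈ Yj 1 1, pw 1 s b (φ b)) * ∑ q : Fin (1 + 1) ⊕ Fin 1, pw 1 s (Sum.inl (Fin.last 1)) q * zk 1 s (insert q ((Yj 1 1).image φ)) =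
      s * ((∏ b ∈ Yj 1 1, pw 1 s b (φ b)) *
        (if Sum.inl (⟨1 - 1, by omega⟩ : Fin (1 + 1)) ∈ (Yj 1 1).image φ then zk 1 s ((Yj 1 1).image φ) else 0)) := by
    intro φ _
    by_cases hw : ∏ b ∈ Yj 1 1, pw 1 s b (φ b) = 0
    · rw [hw]; ring
    · rw [top_sum (k := 1) le_rfl (image_Yj_support hw).1]; ring
  rw [Finset.sum_congr rfl hstep1, ← Finset.mul_sum]
  -- peel `inl 0` off the empty set
  obtain ⟨hY0, hn0⟩ := Yj_succ (k := 1) (j := 0) (by omega)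
  have hYe : Yj 1 0 = ∅ := by ext x; simp [Yj]
  rw [hYe] at hY0 hn0
  rw [hY0, sum_maps_insert (pw 1 s) (fun R => if Sum.inl (⟨1 - 1, by omega⟩ : Fin (1 + 1)) ∈ R then zk 1 s R else 0) hn0]
  simp only [Finset.prod_empty, Finset.image_empty, one_mul, Finset.sum_const, Fintype.card_piFinset,
    Finset.notMem_empty, if_false, Finset.card_singleton, Finset.prod_const_one, one_smul]
  -- the inner sum: only `q = inl 0` survives, with `zk {inl 0} = −1`
  have h0 : (⟨1 - 1, by omega⟩ : Fin (1 + 1)) = ⟨0, by omega⟩ := rfl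
  rw [h0]
  have hzk : zk 1 s ({Sum.inl (⟨0, by omega⟩ : Fin (1 + 1))} : Finset (Fin (1 + 1) ⊕ Fin 1)) = -1 := by
    have hR : ({Sum.inl (⟨0, by omega⟩ : Fin (1 + 1))} : Finset (Fin (1 + 1) ⊕ Fin 1)).toRight = ∅ := by ext; simp
    have hL : Lset 1 ({Sum.inl (⟨0, by omega⟩ : Fin (1 + 1))} : Finset (Fin (1 + 1) ⊕ Fin 1)) = {0} := by
      simp only [Lset, hR, Finset.sdiff_empty]
      ext x; simp [lvlX]
    have hA : Aset 1 ({Sum.inl (⟨0, by omega⟩ : Fin (1 + 1))} : Finset (Fin (1 + 1) ⊕ Fin 1)) = {0} := by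
      ext x; simp [Aset, eq_comm]
    have hguard : ({Sum.inl (⟨0, by omega⟩ : Fin (1 + 1))} : Finset (Fin (1 + 1) ⊕ Fin 1)).card = 1 ∧
        ((Finset.univ : Finset (Fin 1)) \ ({Sum.inl (⟨0, by omega⟩ : Fin (1 + 1))} : Finset (Fin (1 + 1) ⊕ Fin 1)).toRight).card =
          (Lset 1 ({Sum.inl (⟨0, by omega⟩ : Fin (1 + 1))} : Finset (Fin (1 + 1) ⊕ Fin 1))).card := by
      refine ⟨by simp, ?_⟩
      rw [hL, hR, Finset.sdiff_empty]; simp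
    unfold zk
    rw [if_pos hguard, hL, hA]
    have := zetaLA_insert_top s (L := ∅) (A := ∅) (ℓ₀ := 0) (c := 0) (by simp) (by simp)
    rw [Finset.insert_empty] at this
    rw [this, if_pos ⟨by simp, le_rfl⟩, zetaLA_empty]
    simp
  rw [Finset.sum_eq_single (Sum.inl (⟨0, by omega⟩ : Fin (1 + 1)))]
  · rw [Finset.insert_empty, if_pos (Finset.mem_singleton_self _), pw_self, one_mul, hzk]
    simp [hs]
  · intro q _ hq
    rw [Finset.insert_empty, if_neg, mul_zero]
    rw [Finset.mem_singleton]; exact fun h => hq h.symm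
  · intro h; exact (h (Finset.mem_univ _)).elim

/-- Theorem B for every `k ≥ 1`. -/
theorem lambda_Y_ne_zero' {k : ℕ} (hk : 1 ≤ k) (hs : s ≠ 0) :
    ∑ φ ∈ Fintype.piFinset (fun a => if a ∈ (Finset.univ : Finset (Fin (k + 1))).image Sum.inl
        then (Finset.univ : Finset (Fin (k + 1) ⊕ Fin k)) else {a}),
      (∏ a ∈ (Finset.univ : Finset (Fin (k + 1))).image Sum.inl, pw k s a (φ a)) *
        zk k s (((Finset.univ : Finset (Fin (k + 1))).image Sum.inl).image φ) ≠ 0 := by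
  by_cases hk2 : 2 ≤ k
  · exact lambda_Y_ne_zero hk2 hs
  · obtain rfl : k = 1 := by omega
    exact lambda_Y_ne_zero_one hs

/-- ★★ **`P_k` is GOOD for every `k ≥ 1`.** -/
theorem pathTable_det_ne_zero' {k : ℕ} (hk : 1 ≤ k) (hs : s ≠ 0) {r : ℕ}
    (rowS colJ : Fin r → Finset (Fin (k + 1) ⊕ Fin k)) (hinj : Function.Injective rowS)
    (hrow : ∀ i, ((rowS i).card ≤ k ∧ rowS i ≠ (Finset.univ : Finset (Fin k)).image Sum.inr) ∨
      rowS i = (Finset.univ : Finset (Fin (k + 1))).image Sum.inl)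
    (hcol : ∀ J : Finset (Fin (k + 1) ⊕ Fin k), J.card ≤ k → ∃ kk, colJ kk = J) :
    (Matrix.of fun i kk : Fin r => ∏ a ∈ rowS i, ∑ q ∈ colJ kk, pw k s a q).det ≠ 0 :=
  det_ne_zero_of_dual (pw k s) (ppot k) (pw_ne_zero k s) (pw_self k s) k
    ((Finset.univ : Finset (Fin k)).image Sum.inr) ((Finset.univ : Finset (Fin (k + 1))).image Sum.inl) (zk k s)
    (fun R hR => zk_card_ne (by omega)) (fun S hS hX => lambda_row_eq_zero S hS hX) (lambda_Y_ne_zero' hk hs)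
    rowS colJ hinj hrow hcol

/-- ★★ **THE ENTIRE FIRST SHELL OF HALF-BALL, every `t`**: all classes `B_t(2t+1) − A + C` with `|A| = t`, `|C| = t+1`, `A ⊄ C`
(`t − |A ∩ C| ≥ 1`). -/
theorem exists_table_firstShell_all (t : ℕ) (A C : Finset (Fin (2 * t + 1))) (hA : A.card = t) (hC : C.card = t + 1)
    (hk : 1 ≤ t - (A ∩ C).card)
    {r : ℕ} (u cols : Fin r → Finset (Fin (2 * t + 1))) (hu : Function.Injective u)
    (hU : ∀ i, ((u i).card ≤ t ∧ u i ≠ A) ∨ u i = C)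
    (hcols : ∀ J : Finset (Fin (2 * t + 1)), J.card ≤ t → ∃ kk, cols kk = J) :
    ∃ tx : Option (Fin (2 * t + 1)) → Fin (2 * t + 1) → ℂ,
      (Matrix.of fun i kk : Fin r => ∏ a ∈ u i, (tx none a + ∑ q ∈ cols kk, tx (some q) a)).det ≠ 0 := by
  classical
  set j := (A ∩ C).card with hj
  have hjt : j ≤ t := by
    have := Finset.card_le_card (Finset.inter_subset_left : A ∩ C ⊆ A)
    rw [hA] at this; exact this
  obtain ⟨k, hkdef⟩ : ∃ k, t = k + j := ⟨t - j, by omega⟩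
  have hk1 : 1 ≤ k := by omega
  have h1 : (C \ A).card = k + 1 := by
    have := Finset.card_sdiff_add_card_inter C A; rw [Finset.inter_comm] at this; omega
  have h2 : (A \ C).card = k := by have := Finset.card_sdiff_add_card_inter A C; omega
  have h4 : (A ∪ C)ᶜ.card = j := by
    have hU := Finset.card_union_add_card_inter A C
    rw [Finset.card_compl, Fintype.card_fin]; omega
  obtain ⟨e, m1, m2, m3, m4⟩ := exists_equiv_four A C h1 h2 hj.symm h4
  let w : (Fin (k + 1) ⊕ Fin k) ⊕ (Fin j ⊕ Fin j) → (Fin (k + 1) ⊕ Fin k) ⊕ (Fin j ⊕ Fin j) → ℂ :=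
    fun a q => match a, q with
      | Sum.inl a₁, Sum.inl q₁ => pw k 1 a₁ q₁
      | Sum.inl _, Sum.inr _ => 0
      | Sum.inr z, q => if q = Sum.inr z then 1 else 0
  let Z : Finset (Fin j ⊕ Fin j) := (Finset.univ : Finset (Fin j)).image Sum.inl
  have hZ : Z.card = j := by
    simp only [Z]; rw [Finset.card_image_of_injective _ Sum.inl_injective, Finset.card_univ, Fintype.card_fin]
  let rowS : Fin r → Finset ((Fin (k + 1) ⊕ Fin k) ⊕ (Fin j ⊕ Fin j)) := fun i => (u i).map e.symm.toEmbedding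
  let colJ : Fin r → Finset ((Fin (k + 1) ⊕ Fin k) ⊕ (Fin j ⊕ Fin j)) := fun kk => (cols kk).map e.symm.toEmbedding
  have hmem : ∀ x, (e x ∈ A ↔ x ∈ ((Finset.univ : Finset (Fin k)).image Sum.inr).disjSum Z) ∧
      (e x ∈ C ↔ x ∈ ((Finset.univ : Finset (Fin (k + 1))).image Sum.inl).disjSum Z) := by
    intro x
    rcases x with (b | i) | (z | w')
    · have h := m1 b; rw [Finset.mem_sdiff] at h
      simp [Z, h.1, h.2]
    · have h := m2 i; rw [Finset.mem_sdiff] at h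
      simp [Z, h.1, h.2]
    · have h := m3 z; rw [Finset.mem_inter] at h
      simp [Z, h.1, h.2]
    · have h := m4 w'; rw [Finset.mem_compl, Finset.mem_union, not_or] at h
      simp [Z, h.1, h.2]
  have hmapA : A.map e.symm.toEmbedding = ((Finset.univ : Finset (Fin k)).image Sum.inr).disjSum Z := by
    ext x; rw [Finset.mem_map_equiv, Equiv.symm_symm]; exact (hmem x).1
  have hmapC : C.map e.symm.toEmbedding = ((Finset.univ : Finset (Fin (k + 1))).image Sum.inl).disjSum Z := by
    ext x; rw [Finset.mem_map_equiv, Equiv.symm_symm]; exact (hmem x).2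
  have hinj : Function.Injective rowS := fun i i' hij => hu (Finset.map_injective _ hij)
  have hrow : ∀ i, ((rowS i).card ≤ k + Z.card ∧ rowS i ≠ ((Finset.univ : Finset (Fin k)).image Sum.inr).disjSum Z) ∨
      rowS i = ((Finset.univ : Finset (Fin (k + 1))).image Sum.inl).disjSum Z := by
    intro i
    rcases hU i with ⟨hc, hne⟩ | h
    · left
      refine ⟨by simp only [rowS, Finset.card_map, hZ]; omega, fun h => hne ?_⟩
      rw [← hmapA] at h
      exact Finset.map_injective _ h
    · right; simp only [rowS, h, hmapC]
  have hcol : ∀ J : Finset ((Fin (k + 1) ⊕ Fin k) ⊕ (Fin j ⊕ Fin j)), J.card ≤ k + Z.card → ∃ kk, colJ kk = J := by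
    intro J hJ
    obtain ⟨kk, hkk⟩ := hcols (J.map e.toEmbedding) (by rw [Finset.card_map]; omega)
    refine ⟨kk, ?_⟩
    simp only [colJ, hkk, Finset.map_map]
    convert Finset.map_refl (s := J)
    ext x; simp
  have hdet := det_ne_zero_of_dual_inert (pw k 1) (ppot k) (pw_ne_zero k 1) (pw_self k 1) k
    ((Finset.univ : Finset (Fin k)).image Sum.inr) ((Finset.univ : Finset (Fin (k + 1))).image Sum.inl) (zk k 1)
    (fun R hR => zk_card_ne (by omega)) (fun S hS hX => lambda_row_eq_zero S hS hX) (lambda_Y_ne_zero' hk1 one_ne_zero)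
    Z w (fun _ _ => rfl) (fun _ _ => rfl) (fun _ _ => rfl) rowS colJ hinj hrow hcol
  refine ⟨fun o a => match o with | none => 0 | some q => w (e.symm a) (e.symm q), ?_⟩
  convert hdet using 2
  ext i kk
  simp only [Matrix.of_apply, zero_add, rowS, colJ, Finset.prod_map, Finset.sum_map]
  rfl

/-- ★★ **THE ENTIRE FIRST SHELL in the shape of Conjecture GC½** (threshold column family at `h = 2t+1`, `r = 2^{2t}`). -/
theorem gc_cell_firstShell_all (t : ℕ) (A C : Finset (Fin (2 * t + 1))) (hA : A.card = t) (hC : C.card = t + 1)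
    (hk : 1 ≤ t - (A ∩ C).card) {r : ℕ} (hr : r = 2 ^ (2 * t))
    (cols : Fin r → Finset (Fin (2 * t + 1))) (hinj : Function.Injective cols)
    (hthr : ∀ kk J, J ∉ Set.range cols →
      ∑ q ∈ cols kk, (2 ^ (2 * t + 1) + 2 ^ (q : ℕ)) < ∑ q ∈ J, (2 ^ (2 * t + 1) + 2 ^ (q : ℕ)))
    (u : Fin r → Finset (Fin (2 * t + 1))) (hu : Function.Injective u)
    (hU : ∀ i, ((u i).card ≤ t ∧ u i ≠ A) ∨ u i = C) :
    ∃ tx : Option (Fin (2 * t + 1)) → Fin (2 * t + 1) → ℂ,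
      (Matrix.of fun i kk : Fin r => ∏ a ∈ u i, (tx none a + ∑ q ∈ cols kk, tx (some q) a)).det ≠ 0 :=
  exists_table_firstShell_all t A C hA hC hk u cols hu hU (cols_cover_ball hr cols hinj hthr)

end PathTable

end

end Summit.ValiantsHypothesis.ValiantsHypothesis.Theorems.BarrierLever.HiddenStates
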